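import Literature.MathematicalPhysics.QuantumFieldTheory.Balaban1983to89.B9Eq343ResolventHolderRowTowerOfFlatWindow
import Literature.MathematicalPhysics.QuantumFieldTheory.Balaban1983to89.B9Eq342GreenPrimeDstarValueRowTower
import Literature.MathematicalPhysics.QuantumFieldTheory.Balaban1983to89.B9Eq342GreenPrimeTowerGradientRowClosed
import Literature.MathematicalPhysics.QuantumFieldTheory.Balaban1983to89.B9Eq340WeightedHolderRowsProjectionStep

/-!
# `Balaban1983to89.B9Eq343GreenPrimeDstarHolderRowTowerOfFlatWindow` — T. Bałaban, *Propagators for lattice gauge theories in a background field*, Commun. Math. Phys.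
# **99** (1985) 389–434 [Balaban1985BackgroundPropagators] Thm 3.1 (3.43) p. 398, SECOND MEMBER, FOR `G′_k(U)D*_U` ON THE MODEL — **the η-scale HÖLDER row with decay
# of `G′_k(U)D*_Uf` at the tower, `∃ αh Bh δh` BEFORE THE HEIGHT, MODULO THE WINDOWED FLAT LETTER `HflatW`** (the two-point letter of `(L₀+1)⁻¹∂*` on `T_{(L^{n+1}m)}`
# with `cosh` weights of rate `a` inside the Combes–Thomas window `2d(L^{n+1})²(cosh a − 1) ≤ ½`; [B4] (1.9) at `A = 0`, NOT in the tree for general periods): the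
# `G′_k`-STEP — `G′_kD*_U = (1 − X)w`, `w = G_1D*_U`, `X = −G′_k(1 − (Δ′_{a′,k} − Δ^η_U))` (`B9Eq342GreenPrimeDstarValueRowTower.GpOfUk_eq_resolvent_add`), the weighted
# value ∕ Hölder rows of `w` (`B9Eq342CovariantResolventAdjointRowTower`, closed; `B9Eq343ResolventHolderRowTowerOfFlatWindow`, modulo `HflatW`), the LOCAL value and
# covariant-gradient letters of `X` from the OWNER's closed rows (`exists_decayRow_GpOfUk`, `exists_gradRow_GpOfUk`) and the block-diagonal penalty, assembled by HJ's
# `weightedHolderRows_sub_of_localLetters`.  THIS FILE SUPERSEDES `B9Eq343GreenPrimeDstarHolderRowTowerOfFlat` (same proof), whose unwindowed flat letter is not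
# satisfiable uniformly in the periods (so that theorem is vacuous) — see `B9Eq343ResolventHolderRowTowerOfFlatWindow`.

statement-level skeleton of published theorems with citation tags; proofs where landed; nothing here is a claim about the Yang–Mills mass gap

CITATION HEADER (lean-in-tree rule).  Audit cell `pub-balaban`, sub-cell `t4`, BINDER row NE9; filed by NE9 crux-team LEAF PROVER 01 (`b2b-balaban-t4-ne9-formalise-leaf-01`,
gen 93; bears_on: R4/N22).  Source READ first-hand (`paper:balaban1985-cmp99-background-propagators`): p. 398 Thm 3.1 (3.43), p. 397 (3.40), (3.42), p. 394 (3.24)–(3.25).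
COMPOSED BY NAME from the imports.  Nothing printed is a hypothesis except through `HflatW` (DISPLAYED, flat, free resolvent, windowed rate).

WHAT IS PROVED (sorry-free; proof lane — 0 `def`).
* **`exists_holderRow_GpOfUk_covDiv_of_flatWindow`** — for `0 < β ≤ 1`, `SH ≥ 0` with `HflatW`: `∃ αh Bh δh` such that on the model (binders of the value member
  `B9Eq342GreenPrimeDstarValueRowTower.exists_valueRow_GpOfUk_covDiv`), for block-supported bond data `‖f‖ ≤ F` and `d(x,x′) ≤ L^{n+1}`:
  `‖(G′_kD*_Uf)(x′) − (G′_kD*_Uf)(x)‖ ≤ Bh·e^{−δh·d_m(Πx, v)}·(d(x,x′)∕L^{n+1})^β·F`.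
HONEST SCOPE.  CONDITIONAL on `HflatW` (the located open analytic input).  NOT summit progress (cell pub-balaban: NE9 NOT PRINTED ∕ NOT PROVED; «NE9 ⇐ the named binders»;
row WALLED ON A MODEL (O-NE9-1; #5 UNRULED); spine PROVED 0∕9; rung (B)+1 finite T⁴ — NOT infinite volume, NOT mass gap, NOT BetaPertH, NOT Clay).  HONEST DEPENDENCY (cell
line): continuum YM on T⁴ ⇐ BetaPertH ∧ nine spine estimates (0/9 proved); BetaPertH ⇐ (D1) ∧ (D4) ∧ CAP+tail; G-an2-4 gates asym, D1 and NE2/3/4.  NEW file; nothing modified.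
Net new unproved facts: 0.
-/

noncomputable section

open scoped InnerProductSpace ComplexConjugate BigOperators

namespace Literature.MathematicalPhysics.QuantumFieldTheory.Balaban1983to89.B9Eq343GreenPrimeDstarHolderRowTowerOfFlatWindow

open B4Sect5Torus (TSite tdist tdist_nonneg tdist_triangle)
open B4Sect5Proof (latticeConst latticeConst_nonneg)
open B4TorusKernel.MultiPeriod (circAbs)
open B7Prop1Explicit (U1)
open B9SectCLatticeCarrier (Bond bpos btgt shift unshift tdist_shift_le)
open B9Eq311L2Pairing (WL2)
open B9Eq319QprimeTorus (fineP blockCoord)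
open B11Eq103H1Complex (SiteL2K BondL2K covDerivL2K covDivL2K covLaplaceSiteK greenK)
open B9Eq33CovDerivVector (covDeriv)
open B9Eq310HessianOperator (adTransportW)
open B9Eq310HessianHermitian (adTransportW_adjoint)
open B9Eq315QTower (towerP towerP_apply UlevOf)
open B9Eq316TowerFlatIsOneStep (towerP_eq_fineP_pow siteCast)
open B9Eq324DeltaPrimeATower (laplacePrimeAk GpOfUk)
open B9Eq349BlockMultipliers (exists_block_clm_family)
open B9Eq342GreenPrimeTowerDecayRowClosed (exists_decayRow_GpOfUk)
open B9Eq342GreenPrimeTowerGradientRowClosed (exists_gradRow_GpOfUk)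
open B9Eq342GreenPrimeTowerSupBoundDecay (bigBlock_eq_iff)
open B9Eq342TowerBigBlocks (card_sites_bigBlock_le)
open B9Eq324PenaltyBlockLocal (norm_laplacePrimeAk_sub_covLaplace_apply_le_block_diagonal)
open B9Eq347LocalFromBlockDecay (norm_le_sqrt_mass_mul)
open B9Eq343BlockLocalisedHolderPieces (tdist_siteCast tdist_blockCoord_le_one_of_tdist_le)
open B9Eq340WeightedHolderRowsProjectionStep (weightedHolderRows_sub_of_localLetters)
open B9Eq342CovariantResolventAdjointRowLetters (rePos_covLaplaceSiteK_add)
open B9Eq342CovariantResolventAdjointRowTower (exists_decayRow_resolvent_covDiv)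
open B9Eq342GreenPrimeDstarValueRowTower (GpOfUk_eq_resolvent_add)
open B9Eq343ResolventHolderRowTowerOfFlatWindow (exists_holderRow_resolvent_covDiv_of_flatWindow)

/-- weakening an exponential rate. [folklore] -/
private theorem exp_weaken {δ δ' D : ℝ} (h : δ' ≤ δ) (hD : 0 ≤ D) : Real.exp (-(δ * D)) ≤ Real.exp (-(δ' * D)) :=
  Real.exp_le_exp.2 (by nlinarith [mul_le_mul_of_nonneg_right h hD])

/-- moving a block weight by one block at a smaller rate. [folklore] -/
private theorem exp_shift_block {κ κG Dp Dt : ℝ} (hκ : κ ≤ κG) (hκG : 0 ≤ κG) (hDp : 0 ≤ Dp) (hadj : Dp ≤ Dt + 1) :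
    Real.exp (-(κG * Dt)) ≤ Real.exp κG * Real.exp (-(κ * Dp)) := by
  rw [← Real.exp_add]; refine Real.exp_le_exp.2 ?_
  nlinarith [mul_le_mul_of_nonneg_right hκ hDp, mul_le_mul_of_nonneg_left hadj hκG]

/-- the final constant bookkeeping. [folklore] -/
private theorem final_le {BH F d BX Kc B₁ M α αh E e ρ : ℝ} (hF : 0 ≤ F) (hd : 0 ≤ d) (hBX : 0 ≤ BX) (hKc : 0 ≤ Kc) (hB₁ : 0 ≤ B₁) (hM : 0 ≤ M)
    (hαh : α ≤ αh) (hE : 0 ≤ E) (he : 0 ≤ e) (hρ : 0 ≤ ρ) :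
    (BH * F + d * (BX * Kc * (B₁ * F) + M * α * (BX * Kc * (B₁ * F))) * E) * e * ρ ≤ (BH + d * (BX * Kc * B₁) * (1 + M * αh) * E) * e * ρ * F := by
  have h1 : BX * Kc * (B₁ * F) + M * α * (BX * Kc * (B₁ * F)) = (BX * Kc * B₁) * (1 + M * α) * F := by ring
  rw [h1]
  have h2 : 1 + M * α ≤ 1 + M * αh := by nlinarith [mul_le_mul_of_nonneg_left hαh hM]
  have h3 : d * ((BX * Kc * B₁) * (1 + M * α) * F) * E ≤ d * ((BX * Kc * B₁) * (1 + M * αh) * F) * E :=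
    mul_le_mul_of_nonneg_right (mul_le_mul_of_nonneg_left (mul_le_mul_of_nonneg_right (mul_le_mul_of_nonneg_left h2 (by positivity)) hF) hd) hE
  calc (BH * F + d * ((BX * Kc * B₁) * (1 + M * α) * F) * E) * e * ρ ≤ (BH * F + d * ((BX * Kc * B₁) * (1 + M * αh) * F) * E) * e * ρ :=
        mul_le_mul_of_nonneg_right (mul_le_mul_of_nonneg_right (add_le_add le_rfl h3) he) hρ
    _ = _ := by ring

variable {d : ℕ} (L : ℕ) [NeZero L] (hL3 : 3 ≤ L)
  {𝔸 : Type*} [NormedRing 𝔸] [NormedAlgebra ℂ 𝔸] [CompleteSpace 𝔸] [NormOneClass 𝔸] [StarRing 𝔸]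
  {W : Type*} [NormedAddCommGroup W] [InnerProductSpace ℂ W] [FiniteDimensional ℂ W] (φ : W ≃ₗ[ℂ] 𝔸)
  {a' Mφ Mφ' : ℝ} (hMφ : 0 ≤ Mφ) (hMφ' : 0 ≤ Mφ') (hφ : ∀ w, ‖φ w‖ ≤ Mφ * ‖w‖) (hφ' : ∀ X, ‖φ.symm X‖ ≤ Mφ' * ‖X‖) (ha' : 0 < a')
  {r : ℝ} (hr0 : 0 ≤ r) (hr1 : r < 1)
  (τ : 𝔸 →ₗ[ℂ] ℂ) (hτ₂ : ∀ X Y : 𝔸, τ (X * Y) = τ (Y * X)) (hφτ : ∀ X Y : 𝔸, ⟪φ.symm X, φ.symm Y⟫_ℂ = τ (star X * Y))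

include hL3 hMφ hMφ' hφ hφ' ha' hr0 hr1 hτ₂ hφτ in
/-- **[B9] Thm 3.1 (3.43), SECOND MEMBER WITH DECAY, FOR `G′_k(U)D*_U` ON THE MODEL, MODULO THE WINDOWED FLAT TWO-POINT LETTER — `∃ αh Bh δh` BEFORE THE HEIGHT.**
For `1 ≤ d`, `L ≥ 3`, `0 < β ≤ 1`, `SH ≥ 0` with `HflatW` (rate window `2d(L^{n+1})²(cosh a − 1) ≤ ½`): on print's diagonal, for every background of the model with its level letters, any `hpos′`, every bond datum `f` supported
in `Π⁻¹(v)` with `‖f(b)‖ ≤ F` and sites `d(x,x′) ≤ L^{n+1}`: `‖(G′_k(U)D*_Uf)(x′) − (G′_k(U)D*_Uf)(x)‖ ≤ Bh·e^{−δh·d_m(Πx, v)}·(d(x,x′)∕L^{n+1})^β·F`.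
[cite: Balaban1985BackgroundPropagators, Thm 3.1 (3.43) p.398, (3.40) p.397, (3.42) p.397, (3.24)–(3.25) p.394, (3.47) p.398] -/
theorem exists_holderRow_GpOfUk_covDiv_of_flatWindow (hd : 1 ≤ d) {β : ℝ} (hβ0 : 0 < β) (hβ1 : β ≤ 1) (SH : ℝ) (hSH : 0 ≤ SH)
    (HflatW : ∀ (n : ℕ) (η : ℝ), η * (L : ℝ) ^ (n + 1) = 1 → ∀ (c₀ : ℝ) [Fact (0 < c₀)] (m : Fin d → ℕ) [∀ i, NeZero (m i)] (a : ℝ), 0 ≤ a →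
      a * (L : ℝ) ^ (n + 1) ≤ 1 → 2 * (d : ℝ) * ((L : ℝ) ^ (n + 1)) ^ 2 * (Real.cosh a - 1) ≤ 1 / 2 →
      ∀ (x₀ : TSite d (towerP L m (n + 1))) (u : SiteL2K ℂ d (towerP L m (n + 1)) c₀ W) (f : BondL2K ℂ d (towerP L m (n + 1)) c₀ W) (F : ℝ),
      0 ≤ F → covLaplaceSiteK ((η⁻¹ : ℝ) : ℂ) (fun _ : Bond d (towerP L m (n + 1)) => (LinearMap.id : W →ₗ[ℂ] W)) (fun _ => LinearMap.id) u + ((1 : ℝ) : ℂ) • u =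
        covDivL2K ℂ c₀ ((η⁻¹ : ℝ) : ℂ) (fun _ : Bond d (towerP L m (n + 1)) => (LinearMap.id : W →ₗ[ℂ] W)) f →
      (∀ b, ‖WL2.equiv ℂ (fun _ : Bond d (towerP L m (n + 1)) => c₀) W f b‖ ≤ F * ∏ μ, Real.cosh (a * (circAbs (towerP L m (n + 1) μ) ((((x₀ μ : ℕ) : ZMod (towerP L m (n + 1) μ)) - ((bpos b μ : ℕ) : ZMod (towerP L m (n + 1) μ))).val) : ℝ))) →
      ∀ x x', tdist (towerP L m (n + 1)) x x' ≤ (L : ℝ) ^ (n + 1) →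
        ‖WL2.equiv ℂ (fun _ : TSite d (towerP L m (n + 1)) => c₀) W u x' - WL2.equiv ℂ (fun _ : TSite d (towerP L m (n + 1)) => c₀) W u x‖ ≤
          SH * F * (tdist (towerP L m (n + 1)) x x' / (L : ℝ) ^ (n + 1)) ^ β * ∏ μ, Real.cosh (a * (circAbs (towerP L m (n + 1) μ) ((((x₀ μ : ℕ) : ZMod (towerP L m (n + 1) μ)) - ((x μ : ℕ) : ZMod (towerP L m (n + 1) μ))).val) : ℝ))) :
    ∃ αh Bh δh : ℝ, 0 < αh ∧ 0 ≤ Bh ∧ 0 < δh ∧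
      ∀ (n : ℕ) (η : ℝ), η * (L : ℝ) ^ (n + 1) = 1 →
      ∀ (c₀ c₁ : ℝ) [Fact (0 < c₀)] [Fact (0 < c₁)], c₀ * ((L : ℝ) ^ (n + 1)) ^ d = c₁ →
      ∀ (m : Fin d → ℕ) [∀ i, NeZero (m i)] (U : Bond d (towerP L m (n + 1)) → 𝔸ˣ),
      ∀ (α : ℝ), 0 ≤ α → α ≤ αh → (∀ b, U b ∈ U1 𝔸) → (∀ b, ‖(U b : 𝔸) - 1‖ ≤ α * η) →
        (∀ (x : TSite d (towerP L m (n + 1))) (μ : Fin d), ‖(U (x, μ) : 𝔸) - U (unshift μ x, μ)‖ ≤ α * η ^ 2) →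
      ∀ (εU : ℕ → ℝ), (∀ j, 0 ≤ εU j) → (∀ j < n + 1, εU j ≤ α * r ^ j) →
        (∀ (j : ℕ) (b : Bond d (towerP L m (j + 1))), ‖(UlevOf L m (n + 1) U j b : 𝔸) - 1‖ ≤ εU j) →
        (∀ (j : ℕ) (b : Bond d (towerP L m (j + 1))), UlevOf L m (n + 1) U j b ∈ U1 𝔸) →
        (∀ b, star (U b : 𝔸) = ((U b)⁻¹ : 𝔸ˣ)) →
        (∀ (j : ℕ) (b : Bond d (towerP L m (j + 1))) (w : W), ‖adTransportW φ (UlevOf L m (n + 1) U j) b w‖ ≤ ‖w‖) →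
      ∀ (hpos' : ∀ x : SiteL2K ℂ d (towerP L m (n + 1)) c₀ W, x ≠ 0 → 0 < RCLike.re ⟪x, laplacePrimeAk L m n φ η U a' (c₁ := c₁) x⟫_ℂ)
        (v : TSite d m) (f : BondL2K ℂ d (towerP L m (n + 1)) c₀ W) (F : ℝ),
        (∀ b, blockCoord (L ^ (n + 1)) m (siteCast (towerP_eq_fineP_pow L m (n + 1)) (bpos b)) ≠ v →
          WL2.equiv ℂ (fun _ : Bond d (towerP L m (n + 1)) => c₀) W f b = 0) →
        (∀ b, ‖WL2.equiv ℂ (fun _ : Bond d (towerP L m (n + 1)) => c₀) W f b‖ ≤ F) →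
      ∀ x x' : TSite d (towerP L m (n + 1)), tdist (towerP L m (n + 1)) x x' ≤ (L : ℝ) ^ (n + 1) →
        ‖WL2.equiv ℂ (fun _ : TSite d (towerP L m (n + 1)) => c₀) W
              (GpOfUk L m n φ η U a' (c₁ := c₁) hpos' (covDivL2K ℂ c₀ ((η : ℂ))⁻¹ (adTransportW φ fun b => (U b)⁻¹) f)) x' -
            WL2.equiv ℂ (fun _ : TSite d (towerP L m (n + 1)) => c₀) W
              (GpOfUk L m n φ η U a' (c₁ := c₁) hpos' (covDivL2K ℂ c₀ ((η : ℂ))⁻¹ (adTransportW φ fun b => (U b)⁻¹) f)) x‖ ≤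
          Bh * Real.exp (-(δh * tdist m (blockCoord (L ^ (n + 1)) m (siteCast (towerP_eq_fineP_pow L m (n + 1)) x)) v)) *
            (tdist (towerP L m (n + 1)) x x' / (L : ℝ) ^ (n + 1)) ^ β * F := by
  classical
  obtain ⟨α₁, B₁, δ₁, hα₁, hB₁, hδ₁, H1⟩ := exists_decayRow_resolvent_covDiv L hL3 φ hMφ hMφ' hφ hφ' τ hτ₂ hφτ hd
  obtain ⟨αH, BH, δH, hαH, hBH, hδH, H2⟩ :=
    exists_holderRow_resolvent_covDiv_of_flatWindow L hL3 φ hMφ hMφ' hφ hφ' ha' hr0 hr1 τ hτ₂ hφτ hd hβ0 hβ1 SH hSH HflatW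
  obtain ⟨αP, CP, ρP, κP, hαP, hCP, hρP, hκP, _hκPρ, _h2κP, HP⟩ := exists_decayRow_GpOfUk L φ hMφ hMφ' hφ hφ' ha' hr0 hr1 τ hτ₂ hφτ hd
  obtain ⟨αG, BG, κG, hαG, hBG, hκG, HGr⟩ := exists_gradRow_GpOfUk L φ hMφ hMφ' hφ hφ' ha' hr0 hr1 τ hτ₂ hφτ hd (by omega)
  -- the closed letters
  obtain ⟨BP, hBP⟩ : ∃ B : ℝ, B = (1 + |a'| * CP) * (Real.exp (1 / 2) * 2) * (∑ l ∈ Finset.range d, (2 : ℝ) ^ (l + 1)) +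
      Real.sqrt (3 ^ d * 2 ^ d) * Real.sqrt ((Real.exp (1 / 2) * 2) * latticeConst d (Real.sqrt (1 / (4 * d + 1)) - 2 * κP)) * CP := ⟨_, rfl⟩
  have hBP0 : 0 ≤ BP := by rw [hBP]; positivity
  obtain ⟨κ, hκ⟩ : ∃ k : ℝ, k = min κP κG := ⟨_, rfl⟩
  have hκ0 : 0 < κ := by rw [hκ]; exact lt_min hκP hκG
  have hκP' : κ ≤ κP := by rw [hκ]; exact min_le_left _ _
  have hκG' : κ ≤ κG := by rw [hκ]; exact min_le_right _ _
  obtain ⟨BX, hBX⟩ : ∃ B : ℝ, B = (1 + |a'|) * (BP + BG * Real.exp κG) := ⟨_, rfl⟩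
  have hBX0 : 0 ≤ BX := by rw [hBX]; positivity
  have hBXP : (1 + |a'|) * BP ≤ BX := by rw [hBX, mul_add]; exact le_add_of_nonneg_right (by positivity)
  have hBXG : (1 + |a'|) * (BG * Real.exp κG) ≤ BX := by rw [hBX, mul_add]; exact le_add_of_nonneg_left (by positivity)
  obtain ⟨δ₀, hδ₀⟩ : ∃ e : ℝ, e = min δ₁ δH := ⟨_, rfl⟩
  have hδ₀0 : 0 < δ₀ := by rw [hδ₀]; exact lt_min hδ₁ hδH
  have hδ₀1 : δ₀ ≤ δ₁ := by rw [hδ₀]; exact min_le_left _ _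
  have hδ₀H : δ₀ ≤ δH := by rw [hδ₀]; exact min_le_right _ _
  obtain ⟨δ₂, hδ₂⟩ : ∃ e : ℝ, e = min δ₀ (κ / 2) := ⟨_, rfl⟩
  have hδ₂0 : 0 < δ₂ := by rw [hδ₂]; exact lt_min hδ₀0 (half_pos hκ0)
  have hδ₂κ : δ₂ < κ := by rw [hδ₂]; exact (min_le_right _ _).trans_lt (half_lt_self hκ0)
  have hKc : 0 ≤ latticeConst d (κ - δ₂) := latticeConst_nonneg d (by linarith)
  obtain ⟨αh, hαh⟩ : ∃ a : ℝ, a = min (min α₁ αH) (min αP αG) := ⟨_, rfl⟩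
  have hαh0 : 0 < αh := by rw [hαh]; exact lt_min (lt_min hα₁ hαH) (lt_min hαP hαG)
  have hc : 0 ≤ 2 * Mφ * Mφ' := by positivity
  refine ⟨αh, BH + d * (BX * latticeConst d (κ - δ₂) * B₁) * (1 + 2 * Mφ * Mφ' * αh) * Real.exp δ₂, δ₂, hαh0, by positivity, hδ₂0, ?_⟩
  intro n η hηL c₀ c₁ _ _ hw m _ U α hα hαle hUb hUη hUgrad εU hεU hεg hUε hLb hUst hRlev hpos' v f F hfv hfF x x' hxx
  have hc₀ : (0 : ℝ) < c₀ := Fact.out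
  have hc₁ : (0 : ℝ) < c₁ := Fact.out
  have hm : ∀ i, 1 ≤ m i := fun i => Nat.one_le_iff_ne_zero.mpr (NeZero.ne (m i))
  have hP1 : ∀ i, 1 ≤ towerP L m (n + 1) i := fun i => by
    rw [towerP_apply]; exact Nat.one_le_iff_ne_zero.2 (Nat.mul_ne_zero (pow_ne_zero _ (NeZero.ne L)) (NeZero.ne (m i)))
  haveI : NeZero (L ^ (n + 1)) := ⟨pow_ne_zero _ (NeZero.ne L)⟩
  have hF : 0 ≤ F := (norm_nonneg _).trans (hfF (x, ⟨0, hd⟩))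
  have hα₁' : α ≤ α₁ := hαle.trans (by rw [hαh]; exact (min_le_left _ _).trans (min_le_left _ _))
  have hαH' : α ≤ αH := hαle.trans (by rw [hαh]; exact (min_le_left _ _).trans (min_le_right _ _))
  have hαP' : α ≤ αP := hαle.trans (by rw [hαh]; exact (min_le_right _ _).trans (min_le_left _ _))
  have hαG' : α ≤ αG := hαle.trans (by rw [hαh]; exact (min_le_right _ _).trans (min_le_right _ _))
  have hRS : ∀ (b : Bond d (towerP L m (n + 1))) (v u : W), ⟪adTransportW φ U b v, u⟫_ℂ = ⟪v, adTransportW φ (fun b => (U b)⁻¹) b u⟫_ℂ :=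
    adTransportW_adjoint φ τ hτ₂ hUst hφτ
  have hK1 : (1 : ℝ) ≤ (L : ℝ) ^ (n + 1) := one_le_pow₀ (by exact_mod_cast (by omega : 1 ≤ L))
  have hK0 : (0 : ℝ) < (L : ℝ) ^ (n + 1) := lt_of_lt_of_le one_pos hK1
  have hη0 : 0 < η := by nlinarith only [hηL, hK0]
  have hηK : η * ((L ^ (n + 1) : ℕ) : ℝ) = 1 := by rw [Nat.cast_pow]; exact hηL
  have hK1' : (1 : ℝ) ≤ ((L ^ (n + 1) : ℕ) : ℝ) := by rw [Nat.cast_pow]; exact hK1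
  -- positivity of `Δ^η_U + 1`
  have hpos₁ : ∀ z : SiteL2K ℂ d (towerP L m (n + 1)) c₀ W, z ≠ 0 →
      0 < RCLike.re ⟪z, ((covLaplaceSiteK (c₀ := c₀) ((η : ℂ))⁻¹ (adTransportW φ U) (adTransportW φ fun b => (U b)⁻¹) + (1 : ℂ) • LinearMap.id :
        SiteL2K ℂ d (towerP L m (n + 1)) c₀ W →ₗ[ℂ] SiteL2K ℂ d (towerP L m (n + 1)) c₀ W)) z⟫_ℂ := by
    have h := rePos_covLaplaceSiteK_add (c₀ := c₀) η⁻¹ one_pos (adTransportW φ U) (adTransportW φ fun b => (U b)⁻¹) hRS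
    simp only [Complex.ofReal_inv, Complex.ofReal_one] at h
    exact h
  -- §0 `w = G_1D*_Uf` and its two weighted rows (value: closed; Hölder: modulo the flat letter)
  set w : SiteL2K ℂ d (towerP L m (n + 1)) c₀ W := greenK _ hpos₁ (covDivL2K ℂ c₀ ((η : ℂ))⁻¹ (adTransportW φ fun b => (U b)⁻¹) f) with hwdef
  have hwrow : ∀ y, ‖WL2.equiv ℂ (fun _ : TSite d (towerP L m (n + 1)) => c₀) W w y‖ ≤
      (B₁ * F) * Real.exp (-(δ₀ * tdist m (blockCoord (L ^ (n + 1)) m (siteCast (towerP_eq_fineP_pow L m (n + 1)) y)) v)) := fun y => by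
    have h := H1 n η hηL c₀ m U α hα hα₁' hUst hUb hUη hUgrad hpos₁ v f F hF hfv hfF y
    calc _ ≤ _ := h
      _ ≤ B₁ * Real.exp (-(δ₀ * tdist m (blockCoord (L ^ (n + 1)) m (siteCast (towerP_eq_fineP_pow L m (n + 1)) y)) v)) * F :=
          mul_le_mul_of_nonneg_right (mul_le_mul_of_nonneg_left (exp_weaken hδ₀1 (tdist_nonneg m _ _)) hB₁) hF
      _ = _ := by ring
  have hwhold : ∀ y y' : TSite d (towerP L m (n + 1)), tdist (towerP L m (n + 1)) y y' ≤ ((L ^ (n + 1) : ℕ) : ℝ) →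
      ‖WL2.equiv ℂ (fun _ : TSite d (towerP L m (n + 1)) => c₀) W w y' - WL2.equiv ℂ (fun _ : TSite d (towerP L m (n + 1)) => c₀) W w y‖ ≤
        (BH * F) * Real.exp (-(δ₀ * tdist m (blockCoord (L ^ (n + 1)) m (siteCast (towerP_eq_fineP_pow L m (n + 1)) y)) v)) *
          (tdist (towerP L m (n + 1)) y y' / ((L ^ (n + 1) : ℕ) : ℝ)) ^ β := by
    intro y y' hyy
    rw [Nat.cast_pow] at hyy ⊢
    have h := H2 n η hηL c₀ c₁ hw m U α hα hαH' hUb hUη hUgrad εU hεU hεg hUε hLb hUst hRlev hpos' hpos₁ v f F hF hfv hfF y y' hyy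
    have hρ0 : 0 ≤ (tdist (towerP L m (n + 1)) y y' / (L : ℝ) ^ (n + 1)) ^ β := Real.rpow_nonneg (div_nonneg (tdist_nonneg _ _ _) hK0.le) β
    calc _ ≤ _ := h
      _ ≤ BH * Real.exp (-(δ₀ * tdist m (blockCoord (L ^ (n + 1)) m (siteCast (towerP_eq_fineP_pow L m (n + 1)) y)) v)) *
            (tdist (towerP L m (n + 1)) y y' / (L : ℝ) ^ (n + 1)) ^ β * F :=
          mul_le_mul_of_nonneg_right (mul_le_mul_of_nonneg_right (mul_le_mul_of_nonneg_left (exp_weaken hδ₀H (tdist_nonneg m _ _)) hBH) hρ0) hF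
      _ = _ := by ring
  -- the big-block projections and the block masses
  obtain ⟨PS, hPS⟩ := exists_block_clm_family (𝕜 := ℂ) (w := fun _ : TSite d (towerP L m (n + 1)) => c₀) (V := W)
    (fun x : TSite d (towerP L m (n + 1)) => blockCoord (L ^ (n + 1)) m (siteCast (towerP_eq_fineP_pow L m (n + 1)) x))
  have hPS' : ∀ (y : TSite d m) (g : SiteL2K ℂ d (towerP L m (n + 1)) c₀ W) (x : TSite d (towerP L m (n + 1))),
      WL2.equiv ℂ (fun _ : TSite d (towerP L m (n + 1)) => c₀) W (PS y g) x =
        if (∀ i, (x i : ℕ) / L ^ (n + 1) = (y i : ℕ)) then WL2.equiv ℂ (fun _ : TSite d (towerP L m (n + 1)) => c₀) W g x else 0 := by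
    intro y g x; rw [hPS]; exact if_congr (bigBlock_eq_iff L m n x y) rfl rfl
  have hμS : ∀ y : TSite d m, ∑ x : TSite d (towerP L m (n + 1)),
      (if blockCoord (L ^ (n + 1)) m (siteCast (towerP_eq_fineP_pow L m (n + 1)) x) = y then c₀ else 0) ≤ c₁ := by
    intro y
    rw [← Finset.sum_filter, Finset.sum_const, nsmul_eq_mul, ← hw]
    have h := card_sites_bigBlock_le L m (n + 1) y
    have h' : ((Finset.univ.filter (fun x : TSite d (towerP L m (n + 1)) =>
        blockCoord (L ^ (n + 1)) m (siteCast (towerP_eq_fineP_pow L m (n + 1)) x) = y)).card : ℝ) ≤ ((L : ℝ) ^ (n + 1)) ^ d := by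
      exact_mod_cast h
    rw [mul_comm]
    exact mul_le_mul_of_nonneg_left h' hc₀.le
  have hsq : (Real.sqrt c₁)⁻¹ * Real.sqrt c₁ = 1 := inv_mul_cancel₀ (Real.sqrt_pos.2 hc₁).ne'
  -- §1 `M = 1 − (Δ′_{a′,k} − Δ^η_U)` and the block-supported sources `M q`
  obtain ⟨Mop, hMop⟩ : ∃ M : SiteL2K ℂ d (towerP L m (n + 1)) c₀ W →ₗ[ℂ] SiteL2K ℂ d (towerP L m (n + 1)) c₀ W, ∀ z, M z =
      z - (laplacePrimeAk L m n φ η U a' (c₁ := c₁) z - covLaplaceSiteK ((η : ℂ))⁻¹ (adTransportW φ U) (adTransportW φ fun b => (U b)⁻¹) z) :=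
    ⟨LinearMap.id - (laplacePrimeAk L m n φ η U a' (c₁ := c₁) - covLaplaceSiteK ((η : ℂ))⁻¹ (adTransportW φ U) (adTransportW φ fun b => (U b)⁻¹)),
      fun z => rfl⟩
  have hsource : ∀ (v' : TSite d m) (q : TSite d (towerP L m (n + 1)) → W) (F' : ℝ),
      (∀ y, blockCoord (L ^ (n + 1)) m (siteCast (towerP_eq_fineP_pow L m (n + 1)) y) ≠ v' → q y = 0) → (∀ y, ‖q y‖ ≤ F') →
      (∀ y, blockCoord (L ^ (n + 1)) m (siteCast (towerP_eq_fineP_pow L m (n + 1)) y) ≠ v' →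
          WL2.equiv ℂ (fun _ : TSite d (towerP L m (n + 1)) => c₀) W (Mop ((WL2.equiv ℂ (fun _ : TSite d (towerP L m (n + 1)) => c₀) W).symm q)) y = 0) ∧
      (∀ y, ‖WL2.equiv ℂ (fun _ : TSite d (towerP L m (n + 1)) => c₀) W (Mop ((WL2.equiv ℂ (fun _ : TSite d (towerP L m (n + 1)) => c₀) W).symm q)) y‖ ≤
          (1 + |a'|) * F') := by
    intro v' q F' hqv hqF
    have hF'0 : 0 ≤ F' := (norm_nonneg _).trans (hqF x)
    set qL := (WL2.equiv ℂ (fun _ : TSite d (towerP L m (n + 1)) => c₀) W).symm q with hqL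
    have hqLy : ∀ y, WL2.equiv ℂ (fun _ : TSite d (towerP L m (n + 1)) => c₀) W qL y = q y := fun y => by rw [hqL, Equiv.apply_symm_apply]
    have hpen : ∀ y, ‖WL2.equiv ℂ (fun _ : TSite d (towerP L m (n + 1)) => c₀) W (laplacePrimeAk L m n φ η U a' (c₁ := c₁) qL -
        covLaplaceSiteK ((η : ℂ))⁻¹ (adTransportW φ U) (adTransportW φ fun b => (U b)⁻¹) qL) y‖ ≤
        |a'| * (Real.sqrt c₁)⁻¹ * ‖PS (blockCoord (L ^ (n + 1)) m (siteCast (towerP_eq_fineP_pow L m (n + 1)) y)) qL‖ := fun y =>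
      norm_laplacePrimeAk_sub_covLaplace_apply_le_block_diagonal L m n φ U hPS' hRlev hw η a' qL y _ ((bigBlock_eq_iff L m n y _).1 rfl)
    have hmass : ∀ y₀ : TSite d m, ‖PS y₀ qL‖ ≤ Real.sqrt c₁ * F' := fun y₀ =>
      norm_le_sqrt_mass_mul (w := fun _ : TSite d (towerP L m (n + 1)) => c₀)
        (π := fun x : TSite d (towerP L m (n + 1)) => blockCoord (L ^ (n + 1)) m (siteCast (towerP_eq_fineP_pow L m (n + 1)) x))
        y₀ (hμS y₀) (PS y₀ qL) hF'0 (fun z hz => by rw [hPS, if_neg hz]) (fun z => by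
          rw [hPS]
          by_cases hz : blockCoord (L ^ (n + 1)) m (siteCast (towerP_eq_fineP_pow L m (n + 1)) z) = y₀
          · rw [if_pos hz, hqLy]; exact hqF z
          · rw [if_neg hz, norm_zero]; exact hF'0)
    have hmass0 : ∀ y₀ : TSite d m, y₀ ≠ v' → ‖PS y₀ qL‖ ≤ 0 := fun y₀ hy₀ => by
      have h := norm_le_sqrt_mass_mul (w := fun _ : TSite d (towerP L m (n + 1)) => c₀)
        (π := fun x : TSite d (towerP L m (n + 1)) => blockCoord (L ^ (n + 1)) m (siteCast (towerP_eq_fineP_pow L m (n + 1)) x))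
        y₀ (hμS y₀) (PS y₀ qL) le_rfl (fun z hz => by rw [hPS, if_neg hz]) (fun z => by
          rw [hPS]
          by_cases hz : blockCoord (L ^ (n + 1)) m (siteCast (towerP_eq_fineP_pow L m (n + 1)) z) = y₀
          · rw [if_pos hz, hqLy, hqv z (by rw [hz]; exact hy₀), norm_zero]
          · rw [if_neg hz, norm_zero])
      rw [mul_zero] at h; exact h
    have hMopy : ∀ y, WL2.equiv ℂ (fun _ : TSite d (towerP L m (n + 1)) => c₀) W (Mop qL) y =
        q y - WL2.equiv ℂ (fun _ : TSite d (towerP L m (n + 1)) => c₀) W (laplacePrimeAk L m n φ η U a' (c₁ := c₁) qL -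
          covLaplaceSiteK ((η : ℂ))⁻¹ (adTransportW φ U) (adTransportW φ fun b => (U b)⁻¹) qL) y := fun y => by
      rw [hMop, WL2.equiv_sub, Pi.sub_apply, hqLy]
    refine ⟨fun y hy => ?_, fun y => ?_⟩
    · rw [hMopy, hqv y hy, zero_sub, neg_eq_zero, ← norm_le_zero_iff]
      exact (hpen y).trans (mul_nonpos_iff.2 (Or.inl ⟨by positivity, hmass0 _ hy⟩))
    · rw [hMopy]
      refine (norm_sub_le _ _).trans ?_
      calc ‖q y‖ + ‖WL2.equiv ℂ (fun _ : TSite d (towerP L m (n + 1)) => c₀) W (laplacePrimeAk L m n φ η U a' (c₁ := c₁) qL -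
              covLaplaceSiteK ((η : ℂ))⁻¹ (adTransportW φ U) (adTransportW φ fun b => (U b)⁻¹) qL) y‖
          ≤ F' + |a'| * (Real.sqrt c₁)⁻¹ * (Real.sqrt c₁ * F') := add_le_add (hqF y) ((hpen y).trans (mul_le_mul_of_nonneg_left (hmass _) (by positivity)))
        _ = (1 + |a'| * ((Real.sqrt c₁)⁻¹ * Real.sqrt c₁)) * F' := by ring
        _ = (1 + |a'|) * F' := by rw [hsq, mul_one]
  -- §2 `X = −G′_k(1 − (Δ′ − Δ^η_U))` read on the site functions and its LOCAL value ∕ covariant-gradient letters (the OWNER's closed rows)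
  obtain ⟨X, hX⟩ : ∃ X : (TSite d (towerP L m (n + 1)) → W) →ₗ[ℂ] (TSite d (towerP L m (n + 1)) → W), ∀ q,
      X q = -(WL2.equiv ℂ (fun _ : TSite d (towerP L m (n + 1)) => c₀) W
        (GpOfUk L m n φ η U a' (c₁ := c₁) hpos' (Mop ((WL2.equiv ℂ (fun _ : TSite d (towerP L m (n + 1)) => c₀) W).symm q)))) :=
    ⟨-((WL2.linearEquiv ℂ ℂ (fun _ : TSite d (towerP L m (n + 1)) => c₀)).toLinearMap ∘ₗ (GpOfUk L m n φ η U a' (c₁ := c₁) hpos' ∘ₗ Mop) ∘ₗ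
      (WL2.linearEquiv ℂ ℂ (fun _ : TSite d (towerP L m (n + 1)) => c₀)).symm.toLinearMap), fun _ => rfl⟩
  have hXv : ∀ (v' : TSite d m) (q : TSite d (towerP L m (n + 1)) → W) (F' : ℝ),
      (∀ y, blockCoord (L ^ (n + 1)) m (siteCast (towerP_eq_fineP_pow L m (n + 1)) y) ≠ v' → q y = 0) → (∀ y, ‖q y‖ ≤ F') →
      ∀ y, ‖X q y‖ ≤ BX * Real.exp (-(κ * tdist m (blockCoord (L ^ (n + 1)) m (siteCast (towerP_eq_fineP_pow L m (n + 1)) y)) v')) * F' := by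
    intro v' q F' hqv hqF y
    have hF'0 : 0 ≤ F' := (norm_nonneg _).trans (hqF x)
    obtain ⟨hsupp, hbound⟩ := hsource v' q F' hqv hqF
    rw [hX, Pi.neg_apply, norm_neg]
    have h := HP n η hηL c₀ c₁ hw m U hRS α hα hαP' hUb hUη εU hεU hεg hUε hLb hUst hRlev hpos' PS hPS v' y
      (Mop ((WL2.equiv ℂ (fun _ : TSite d (towerP L m (n + 1)) => c₀) W).symm q)) ((1 + |a'|) * F') hsupp hbound
    rw [← hBP] at h
    refine h.trans ?_
    calc BP * Real.exp (-(κP * tdist m (blockCoord (L ^ (n + 1)) m (siteCast (towerP_eq_fineP_pow L m (n + 1)) y)) v')) * ((1 + |a'|) * F')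
        ≤ BP * Real.exp (-(κ * tdist m (blockCoord (L ^ (n + 1)) m (siteCast (towerP_eq_fineP_pow L m (n + 1)) y)) v')) * ((1 + |a'|) * F') :=
          mul_le_mul_of_nonneg_right (mul_le_mul_of_nonneg_left (exp_weaken hκP' (tdist_nonneg m _ _)) hBP0) (by positivity)
      _ = ((1 + |a'|) * BP) * Real.exp (-(κ * tdist m (blockCoord (L ^ (n + 1)) m (siteCast (towerP_eq_fineP_pow L m (n + 1)) y)) v')) * F' := by ring
      _ ≤ _ := mul_le_mul_of_nonneg_right (mul_le_mul_of_nonneg_right hBXP (Real.exp_pos _).le) hF'0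
  have hcd : ∀ u : SiteL2K ℂ d (towerP L m (n + 1)) c₀ W, covDeriv ((η : ℂ))⁻¹ (adTransportW φ U) (WL2.equiv ℂ (fun _ : TSite d (towerP L m (n + 1)) => c₀) W u) =
      WL2.equiv ℂ (fun _ : Bond d (towerP L m (n + 1)) => c₀) W (covDerivL2K ℂ c₀ ((η : ℂ))⁻¹ (adTransportW φ U) u) := fun u => rfl
  have hXg : ∀ (v' : TSite d m) (q : TSite d (towerP L m (n + 1)) → W) (F' : ℝ),
      (∀ y, blockCoord (L ^ (n + 1)) m (siteCast (towerP_eq_fineP_pow L m (n + 1)) y) ≠ v' → q y = 0) → (∀ y, ‖q y‖ ≤ F') →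
      ∀ b : Bond d (towerP L m (n + 1)), ‖covDeriv ((η : ℂ))⁻¹ (adTransportW φ U) (X q) b‖ ≤
        BX * Real.exp (-(κ * tdist m (blockCoord (L ^ (n + 1)) m (siteCast (towerP_eq_fineP_pow L m (n + 1)) (bpos b))) v')) * F' := by
    intro v' q F' hqv hqF b
    have hF'0 : 0 ≤ F' := (norm_nonneg _).trans (hqF x)
    obtain ⟨hsupp, hbound⟩ := hsource v' q F' hqv hqF
    rw [hX, map_neg, Pi.neg_apply, norm_neg, hcd]
    have h := HGr n η hηL c₀ c₁ hw m U hRS α hα hαG' hUb hUη hUgrad εU hεU hεg hUε hLb hUst hRlev hpos' PS hPS v'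
      (Mop ((WL2.equiv ℂ (fun _ : TSite d (towerP L m (n + 1)) => c₀) W).symm q)) ((1 + |a'|) * F') (by positivity) hsupp hbound b
    refine h.trans ?_
    have hadj : tdist m (blockCoord (L ^ (n + 1)) m (siteCast (towerP_eq_fineP_pow L m (n + 1)) (bpos b))) v' ≤
        tdist m (blockCoord (L ^ (n + 1)) m (siteCast (towerP_eq_fineP_pow L m (n + 1)) (btgt b))) v' + 1 := by
      have h1 := tdist_triangle hm (blockCoord (L ^ (n + 1)) m (siteCast (towerP_eq_fineP_pow L m (n + 1)) (bpos b)))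
        (blockCoord (L ^ (n + 1)) m (siteCast (towerP_eq_fineP_pow L m (n + 1)) (btgt b))) v'
      have h2 : tdist m (blockCoord (L ^ (n + 1)) m (siteCast (towerP_eq_fineP_pow L m (n + 1)) (bpos b)))
          (blockCoord (L ^ (n + 1)) m (siteCast (towerP_eq_fineP_pow L m (n + 1)) (btgt b))) ≤ 1 :=
        tdist_blockCoord_le_one_of_tdist_le (L ^ (n + 1)) m hm _ _ (by
          rw [tdist_siteCast]; exact (tdist_shift_le hP1 b.2 b.1).trans hK1')
      linarith
    calc BG * ((1 + |a'|) * F') * Real.exp (-(κG * tdist m (blockCoord (L ^ (n + 1)) m (siteCast (towerP_eq_fineP_pow L m (n + 1)) (btgt b))) v'))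
        ≤ BG * ((1 + |a'|) * F') * (Real.exp κG *
            Real.exp (-(κ * tdist m (blockCoord (L ^ (n + 1)) m (siteCast (towerP_eq_fineP_pow L m (n + 1)) (bpos b))) v'))) :=
          mul_le_mul_of_nonneg_left (exp_shift_block hκG' hκG.le (tdist_nonneg m _ _) hadj) (by positivity)
      _ = ((1 + |a'|) * (BG * Real.exp κG)) * Real.exp (-(κ * tdist m (blockCoord (L ^ (n + 1)) m (siteCast (towerP_eq_fineP_pow L m (n + 1)) (bpos b))) v')) * F' := by
          ring
      _ ≤ _ := mul_le_mul_of_nonneg_right (mul_le_mul_of_nonneg_right hBXG (Real.exp_pos _).le) hF'0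
  -- §3 the projection step in the weighted Hölder currency (HJ) and the identification `G′_kD*_Uf = (1 − X)w`
  have hres := weightedHolderRows_sub_of_localLetters (L ^ (n + 1)) m φ hφ hφ' hMφ hMφ' (towerP_eq_fineP_pow L m (n + 1)) hm U hη0 hηK hα hUb hUη
    X hBX0 hκ0 hXv hXg (WL2.equiv ℂ (fun _ : TSite d (towerP L m (n + 1)) => c₀) W w) v
    (mul_nonneg hB₁ hF) (mul_nonneg hBH hF) hδ₀0.le hβ1 hwrow hwhold
  have hid := GpOfUk_eq_resolvent_add L m n φ η U a' hpos' hpos₁ (covDivL2K ℂ c₀ ((η : ℂ))⁻¹ (adTransportW φ fun b => (U b)⁻¹) f)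
  rw [← hwdef] at hid
  have hMopw := hMop w
  have hrepr : ∀ y, WL2.equiv ℂ (fun _ : TSite d (towerP L m (n + 1)) => c₀) W
      (GpOfUk L m n φ η U a' (c₁ := c₁) hpos' (covDivL2K ℂ c₀ ((η : ℂ))⁻¹ (adTransportW φ fun b => (U b)⁻¹) f)) y =
      (WL2.equiv ℂ (fun _ : TSite d (towerP L m (n + 1)) => c₀) W w - X (WL2.equiv ℂ (fun _ : TSite d (towerP L m (n + 1)) => c₀) W w)) y := by
    intro y
    rw [Pi.sub_apply, hX, Pi.neg_apply, sub_neg_eq_add, Equiv.symm_apply_apply, hMopw, hid, WL2.equiv_add, Pi.add_apply]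
  rw [hrepr x, hrepr x']
  have hfin := hres.2 x x' (by rw [Nat.cast_pow]; exact hxx)
  rw [← hδ₂, Nat.cast_pow] at hfin
  refine hfin.trans ?_
  exact final_le hF (Nat.cast_nonneg d) hBX0 hKc hB₁ hc hαle (Real.exp_pos _).le (Real.exp_pos _).le
    (Real.rpow_nonneg (div_nonneg (tdist_nonneg _ _ _) hK0.le) β)

end Literature.MathematicalPhysics.QuantumFieldTheory.Balaban1983to89.B9Eq343GreenPrimeDstarHolderRowTowerOfFlatWindow

end
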